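import Summits.BirchSwinnertonDyer.BirchSwinnertonDyer.Theorems.BiquadraticEisensteinDescentEisensteinHeartFlatCMInertBadKPrimeKatzHsiehDisplay
import HarnessLib

set_option linter.dupNamespace false -- `Summit.BirchSwinnertonDyer.BirchSwinnertonDyer.Theorems.…` (summit = sub)
set_option autoImplicit false

/-!
# Crux `EisensteinHeartFlatCMInertBadKPrime` (stmt-BirchSwinnertonDyer-21341), line `hsieh-lambda`, layer 2 (V2):
# THE V2 STUB CLOSER — existence of a Katz base-change-line frame generating the Hsieh witness's ideal up to
# non-zero constants, from the Katz–Hida–Tilouine existence fact and the print-shaped hypotheses (T)(C)(L)(P)(R)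

Route `BiquadraticEisensteinDescent` (cell `pub/bsd-wall`, width seat `bsd-wall-cm-bed-w3`). Sequel of
`…KatzHsiehRigidity.lean` (p607524), `…KatzHsiehDisplay.lean` (p608422) and the V1 existence theorem
`KatzCM.exists_isBaseChangeLine'` (w3 g0, p598961): composes them into the conclusion SHAPE of the V2 stub of the
line's skeleton v2 — `∀ Hsieh witness Q_H, ∃ Katz frame (C_K, Ω, Ω′_p, G) with KatzCM.IsBaseChangeLine … G ∧
∃ c c′ ≠ 0, (C(c)·G) = (C(c′)·Q_H)` — so that the stub is closed MODULO: the named fact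
`hsieh2014mu_prop49_exists_isMeasure` with its hypotheses at the concrete `(L = K_CM·K′, Σ_p = {𝔓′}, ϑ, S, T, D,
λ = ψ_W∘N_{L/K_CM}·N_L⁻¹)`; (T) the Katz type `k = 1`, `κ_n = (n, n−1)` of `λ·χ∘N_{L/K′}`; (C) entire continuation;
(L) `L(λ·χ∘N, 0) = c_L c_L′ⁿ L(f/K′, χ, 1)`; (P) `p ∣ N`, `a_p(f) = 0` (discharged at the crux's data by
`…CuspCoeffVanishing.lean`, p609422); (R) ramification of `λ` on `S ∪ {w ∣ p} ∪ Σ_p ∪ T`; and the residual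
non-vanishing `Im σ_w(ϑ) ≠ 0`, `A, Ω_K, C_H, Ω_p ≠ 0`. THEOREMS ONLY (no definition, no named fact, no `sorry`);
supports stmt-BirchSwinnertonDyer-21341 as a helper; nothing of (T)/(L), of the Katz fact, or of any case of BSD is asserted.

References: [Hsieh2014mu] Prop. 4.9 (§4.8); [Hsieh2014] Thm. A (Doc. Math. 19 p. 712); [Katz1978] (5.3.0);
[HidaTilouine1993] Thm. II; [Castella2018] Thm. 3.1.
-/

noncomputable section

open scoped Classical Topology NumberField
open Filter NumberField IsDedekindDomain Field PowerSeries Finset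
open Literature.NumberTheory.EllipticCurves Literature.NumberTheory.GaloisRepresentations
open Literature.NumberTheory.EllipticCurves.ModularForms

namespace Summit.BirchSwinnertonDyer.BirchSwinnertonDyer.Theorems.BiquadraticEisensteinDescentEisensteinHeartFlatCMInertBadKPrimeKatzHsiehSocket

open Summit.BirchSwinnertonDyer.BirchSwinnertonDyer.Theorems.BiquadraticEisensteinDescentEisensteinHeartFlatCMInertBadKPrimeKatzHsiehDisplay

variable {p : ℕ} [Fact p.Prime] {K L : Type} [Field K] [NumberField K] [Field L] [NumberField L]
  [Algebra K L] [IsGalois K L]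

/-! ### The V2 stub of skeleton v2, closed modulo its print-shaped hypotheses -/

/-- **V2 STUB CLOSER — existence of a Katz base-change-line frame generating the Hsieh ideal up to non-zero
constants.** Granted the Katz–Hida–Tilouine existence fact `hsieh2014mu_prop49_exists_isMeasure` with its hypotheses
at `(L, Σ_p, ϑ, S, T, D, λ)` (verbatim those of `KatzCM.exists_isBaseChangeLine'`: `p > 2`, `p ∤ D_{L⁺}`, `Σ_p` a
`p`-adic CM type, (d1)/(d2) for `ϑ`, the modulus bookkeeping for `S ⊇ T`, `D`, `λ` unramified outside `S ∪ {w ∣ p}`,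
the restricted `ℤ_p`-extension `κ ∘ res` with generator `γ_L`), and granted the print-shaped hypotheses (T) Katz type
`k = 1`, `κ_n = (n, n−1)` on the range, (C) continuation, (L) the `L`-value identity, (P) `p ∣ N`, `a_p(f) = 0`,
(R) `λ` ramified on `S ∪ {w ∣ p}` and `Σ_p ∪ T`, and `Im σ_w(ϑ) ≠ 0`, `A, Ω_K, C_H, Ω_p ≠ 0`: for every Hsieh
witness `Q_H` (`IsHsiehLFunction ι 𝔭 κ γ f A Ω_K C_H Ω_p Q_H`) THERE IS a Katz frame `(C_K ≠ 0, Ω_w ≠ 0, ‖Ω′_{p,w}‖ = 1,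
G)` with `KatzCM.IsBaseChangeLine ι Σ_p S T κ γ λ ϑ C_K Ω Ω′_p G` AND `c, c′ ∈ 𝒪_{ℂ_p} ∖ 0` with
`(C(c)·G) = (C(c′)·Q_H)` — the conclusion shape of the V2 stub of skeleton v2 (its `G` is what V4 must divide, its
`hspan` is what `heartShape_of_sockets` consumes). Odd `p`, `K` imaginary quadratic, `κ` anticyclotomic, `γ` a
topological generator. Nothing of (T)/(L) or of the Katz fact is asserted. [cite: Hsieh2014mu, Prop. 4.9 (§4.8)]
[cite: Hsieh2014, Thm. A p. 712 (Doc. Math. 19)] [cite: Castella2018, Thm. 3.1 (arXiv:1704.06608 p. 9)] -/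
theorem exists_isBaseChangeLine_span_C_mul_eq {ι : PadicAlgCl p ≃+* ℂ} {κ : ZpExtension K p}
    {γ : absoluteGaloisGroup K} (hp2 : p ≠ 2) (hK : IsImaginaryQuadratic K) (hκ : κ.IsAnticyclotomic)
    (hγ : κ.IsTopGenerator γ)
    -- the Katz existence fact and its hypotheses at `(L, Σ_p, ϑ, S, T, D, λ, κ ∘ res, γ_L)`
    (hKatz : hsieh2014mu_prop49_exists_isMeasure) [IsCMField L]
    (hunrL : ¬ (p : ℤ) ∣ NumberField.discr (maximalRealSubfield L))
    {Sp S T D : Finset (HeightOneSpectrum (𝓞 L))} (hSp : KatzCM.IsPAdicCMType p Sp) {ϑ : L}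
    (hϑ₁ : ∀ σ : L →+* ℂ, (σ ϑ).re = 0) (hϑ₂ : ∀ σ : L →+* ℂ, KatzCM.InSigma ι Sp σ → 0 < (σ ϑ).im)
    (hS : ∀ w ∈ S, ((p : ℕ) : 𝓞 L) ∉ w.asIdeal) (hTS : T ⊆ S)
    (hTc : ∀ w ∈ T, IsCMField.complexConj L • w ≠ w ∧ IsCMField.complexConj L • w ∉ T)
    (hST : ∀ w ∈ S, IsCMField.complexConj L • w ≠ w → (w ∈ T ∨ IsCMField.complexConj L • w ∈ T))
    (hD₁ : KatzCM.primesOver L p ⊆ D) (hD₂ : S ⊆ D) (hD₃ : ∀ w ∈ S, IsCMField.complexConj L • w ∈ D)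
    (hD₄ : ∀ w : HeightOneSpectrum (𝓞 L), w.asIdeal.ramificationIdx (𝓞 (maximalRealSubfield L)) ≠ 1 → w ∈ D)
    (hd2 : ∀ w ∈ D, ordAt w (2 * ϑ) = differentExponentAt w) {lam : HeckeCharacter L}
    (hlam : ∀ w : HeightOneSpectrum (𝓞 L), w ∉ S → ((p : ℕ) : 𝓞 L) ∉ w.asIdeal → lam.IsUnramifiedAt w)
    (hs : Function.Surjective (κ.toContinuousMonoidHom.comp (absGaloisRestrict K L)))
    {γL : absoluteGaloisGroup L} (hγL : (κ.restrict L hs).IsTopGenerator γL)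
    -- the Hsieh witness
    {N : ℕ} {f : CuspForm (CongruenceSubgroup.Gamma0 N) 2} {𝔭 : HeightOneSpectrum (𝓞 K)} {A : ℝ} {ΩK CH : ℂ}
    {Ωp : ℂ_[p]} {QH : PowerSeries 𝓞_ℂ_[p]} (hQH : IsHsiehLFunction ι 𝔭 κ γ f A ΩK CH Ωp QH)
    -- (T), (C), (L), (P), (R) and the residual non-vanishing
    {w₁ w₂ : InfinitePlace L} (hw : w₁ ≠ w₂) (huniv : ∀ w : InfinitePlace L, w = w₁ ∨ w = w₂)
    (hT : ∀ (χ : HeckeCharacter K) (n : ℕ), 0 < n → (∀ v : HeightOneSpectrum (𝓞 K), χ.IsUnramifiedAt v) →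
      χ.HasInfinityType (fun _ ↦ (n : ℤ)) (fun _ ↦ -(n : ℤ)) →
      KatzCM.HasKatzType ι Sp (lam * χ.compRelNorm L) 1 (fun w ↦ if w = w₁ then n else n - 1))
    (hcont : ∀ (χ : HeckeCharacter K) (n : ℕ), 0 < n → (∀ v : HeightOneSpectrum (𝓞 K), χ.IsUnramifiedAt v) →
      χ.HasInfinityType (fun _ ↦ (n : ℤ)) (fun _ ↦ -(n : ℤ)) →
      LFunction.HasEntireContinuation (heckeLFunction (lam * χ.compRelNorm L)))
    {cL cL' : ℂ} (hcL : cL ≠ 0) (hcL' : cL' ≠ 0)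
    (hLval : ∀ (χ : HeckeCharacter K) (n : ℕ), 0 < n → (∀ v : HeightOneSpectrum (𝓞 K), χ.IsUnramifiedAt v) →
      χ.HasInfinityType (fun _ ↦ (n : ℤ)) (fun _ ↦ -(n : ℤ)) →
      ∀ hL : LFunction.HasEntireContinuation (heckeLFunction (lam * χ.compRelNorm L)),
        hL.continuation 0 = cL * cL' ^ n * rankinSelbergValueHecke f χ 1)
    (hpN : p ∣ N) (hap : cuspCoeff f p = 0)
    (hramS : ∀ w ∈ S ∪ KatzCM.primesOver L p, ¬ lam.IsUnramifiedAt w)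
    (hramT : ∀ w ∈ Sp ∪ T, ¬ lam.IsUnramifiedAt w)
    (hIm : ∀ w, (KatzCM.embeddingAt ι Sp w ϑ).im ≠ 0)
    (hA : A ≠ 0) (hΩK : ΩK ≠ 0) (hCH : CH ≠ 0) (hΩp : Ωp ≠ 0) :
    ∃ (CK : ℂ) (Ω : InfinitePlace L → ℂ) (ΩpK : InfinitePlace L → ℂ_[p]) (G : PowerSeries 𝓞_ℂ_[p]),
      CK ≠ 0 ∧ (∀ w, Ω w ≠ 0) ∧ (∀ w, ‖ΩpK w‖ = 1) ∧
      KatzCM.IsBaseChangeLine ι Sp S T κ γ lam ϑ CK Ω ΩpK G ∧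
      ∃ c c' : 𝓞_ℂ_[p], c ≠ 0 ∧ c' ≠ 0 ∧
        Ideal.span ({C c * G} : Set (PowerSeries 𝓞_ℂ_[p])) = Ideal.span {C c' * QH} := by
  have hp : p.Prime := Fact.out
  have hp3 : 2 < p := lt_of_le_of_ne hp.two_le (Ne.symm hp2)
  obtain ⟨CK, Ω, ΩpK, G, hCK, hΩ, hΩpK, hGK⟩ :=
    KatzCM.exists_isBaseChangeLine' (S := S) (T := T) hKatz hp3 hunrL hSp hϑ₁ hϑ₂ hS hTS hTc hST hD₁ hD₂
      hD₃ hD₄ hd2 hlam hs hγ hγL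
  have hΩpK0 : ∀ w, ΩpK w ≠ 0 := fun w h ↦ by
    have := hΩpK w
    rw [h, norm_zero] at this
    exact zero_ne_one this
  refine ⟨CK, Ω, ΩpK, G, hCK, hΩ, hΩpK, hGK, ?_⟩
  exact exists_span_C_mul_eq hp2 hK hκ hγ hQH hGK hw huniv hT hcont hcL hcL' hLval hpN hap hramS hramT hCK hΩ
    hIm hΩpK0 hA hΩK hCH hΩp

end Summit.BirchSwinnertonDyer.BirchSwinnertonDyer.Theorems.BiquadraticEisensteinDescentEisensteinHeartFlatCMInertBadKPrimeKatzHsiehSocket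

end
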